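import Mathlib
import HarnessLib
import Summits.CriticalPhenomena.CardyFormulaZ2.Theses.CardyIKTransport

/-!
# Crux-ideate sketch (ideator 3) — crux `CornerLineDescent` (stmt-CriticalPhenomena-10964)

First lemmas of the idea cards `dislocation-seam-calculus` and `poisson-corner-refinement-tower`,
stated over the crux's own inline i.i.d.-bit gauge, abstracted in the plaquette-defect density `p`
(`cornerCrossingProb p R δ`; the crux's `P_IK` is `p = 2√3 − 3`, bond-ℤ² on the renewal grid is `p = 0`,
the i.i.d. colouring SZ² is `p = 1/2`; corner fugacity `t = p/(1-p)`).
`cornerLineDescent_eq` certifies by `rfl` that the crux BY NAME is the `p = p_IK` instance.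
Every other `def … : Prop` is a STATEMENT (nothing is claimed proved here).
-/

namespace Summit.CriticalPhenomena.CardyFormulaZ2.Cruxes.CornerLineDescent.IdeatorThree

open scoped BigOperators Topology Manifold Classical MeasureTheory ProbabilityTheory Matrix InnerProductSpace ComplexConjugate ContinuousMap
open Filter Set Function TopologicalSpace MeasureTheory
open Literature.Probability.Percolation Literature.Probability.LatticeModels
open Literature.Probability.RandomPlanarGeometry

/-- The bit space of the gauge: column bits `A`, row bits `B`, plaquette defects `D`,
(unused) fair defect field, saddle coins. -/
abbrev Bits : Type :=
  Set ℤ × (Set ℤ × (Set (Site 2) × (Set (Site 2) × Set (Site 2))))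

/-- The corner-line product measure with plaquette-defect density `p` (clamped to `[0,1]`). -/
noncomputable def cornerMeasure (p : ℝ) : Measure Bits :=
  (Literature.Probability.Percolation.sitePercolation ℤ Literature.Probability.Percolation.half).prod ((Literature.Probability.Percolation.sitePercolation ℤ Literature.Probability.Percolation.half).prod ((Literature.Probability.Percolation.sitePercolation (Literature.Probability.LatticeModels.Site 2) (Set.projIcc (0:ℝ) 1 zero_le_one p)).prod ((Literature.Probability.Percolation.sitePercolation (Literature.Probability.LatticeModels.Site 2) Literature.Probability.Percolation.half).prod (Literature.Probability.Percolation.sitePercolation (Literature.Probability.LatticeModels.Site 2) Literature.Probability.Percolation.half))))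

/-- Colour of cell `v` (`A_{v0} ⊕ B_{v1} ⊕` parity of the defects in the rectangle between `0` and `v`):
verbatim the crux's `blk` with its `par` (all columns isotropic, `S = univ`). -/
def cornerColour : Bits → Literature.Probability.LatticeModels.Site 2 → Prop :=
  let par : (Set ℤ × (Set ℤ × (Set (Literature.Probability.LatticeModels.Site 2) × (Set (Literature.Probability.LatticeModels.Site 2) × Set (Literature.Probability.LatticeModels.Site 2))))) → Literature.Probability.LatticeModels.Site 2 → Prop := fun ω f => (f 0 ∈ (Set.univ : Set ℤ) ∧ f ∈ ω.2.2.1) ∨ (f 0 ∉ (Set.univ : Set ℤ) ∧ f ∈ ω.2.2.2.1); fun ω v => Xor (v 0 ∈ ω.1) (Xor (v 1 ∈ ω.2.1) (Odd ((Finset.filter (fun f : ℤ × ℤ => par ω ![f.1, f.2]) (Finset.Ico (min 0 (v 0)) (max 0 (v 0)) ×ˢ Finset.Ico (min 0 (v 1)) (max 0 (v 1)))).card)))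

/-- Crude crossing probability of `R` at mesh `δ` for the corner-line model with defect density `p`
(cells at `v0 + i v1`): verbatim the crux's `P` with `2√3 − 3` replaced by `p`. -/
noncomputable def cornerCrossingProb (p : ℝ) :
    Literature.Probability.RandomPlanarGeometry.ConformalRectangle → ℝ → ℝ :=
  (fun R => let μ := (Literature.Probability.Percolation.sitePercolation ℤ Literature.Probability.Percolation.half).prod ((Literature.Probability.Percolation.sitePercolation ℤ Literature.Probability.Percolation.half).prod ((Literature.Probability.Percolation.sitePercolation (Literature.Probability.LatticeModels.Site 2) (Set.projIcc (0:ℝ) 1 zero_le_one p)).prod ((Literature.Probability.Percolation.sitePercolation (Literature.Probability.LatticeModels.Site 2) Literature.Probability.Percolation.half).prod (Literature.Probability.Percolation.sitePercolation (Literature.Probability.LatticeModels.Site 2) Literature.Probability.Percolation.half)))); let par : (Set ℤ × (Set ℤ × (Set (Literature.Probability.LatticeModels.Site 2) × (Set (Literature.Probability.LatticeModels.Site 2) × Set (Literature.Probability.LatticeModels.Site 2))))) → Literature.Probability.LatticeModels.Site 2 → Prop := fun ω f => (f 0 ∈ (Set.univ : Set ℤ) ∧ f ∈ ω.2.2.1)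 ∨ (f 0 ∉ (Set.univ : Set ℤ) ∧ f ∈ ω.2.2.2.1); let blk : (Set ℤ × (Set ℤ × (Set (Literature.Probability.LatticeModels.Site 2) × (Set (Literature.Probability.LatticeModels.Site 2) × Set (Literature.Probability.LatticeModels.Site 2))))) → Literature.Probability.LatticeModels.Site 2 → Prop := fun ω v => Xor (v 0 ∈ ω.1) (Xor (v 1 ∈ ω.2.1) (Odd ((Finset.filter (fun f : ℤ × ℤ => par ω ![f.1, f.2]) (Finset.Ico (min 0 (v 0)) (max 0 (v 0)) ×ˢ Finset.Ico (min 0 (v 1)) (max 0 (v 1)))).card))); let anti : (Set ℤ × (Set ℤ × (Set (Literature.Probability.LatticeModels.Site 2) × (Set (Literature.Probability.LatticeModels.Site 2) × Set (Literature.Probability.LatticeModels.Site 2))))) → Literature.Probability.LatticeModels.Site 2 → Prop := fun ω f => f 0 ∉ (Set.univ : Set ℤ) ∨ f ∈ ω.2.2.2.2; let edges : (Set ℤ × (Set ℤ × (Set (Literature.Probability.LatticeModels.Site 2) × (Set (Literature.Probability.LatticeModels.Site 2) × Set (Literature.Probability.LatticeModels.Site 2))))) → Literature.Probability.Percolation.BondConfig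 (Literature.Probability.LatticeModels.Site 2) := fun ω => {e | ∃ u v, e = s(u, v) ∧ blk ω u ∧ blk ω v ∧ (v = u + ![1, 0] ∨ v = u + ![0, 1] ∨ (v = u + ![1, 1] ∧ ¬ anti ω u) ∨ (v = u + ![1, -1] ∧ anti ω (u + ![0, -1])))}; fun δ : ℝ => μ.real {ω | edges ω ∈ Literature.Probability.Percolation.embDomainCrossing (fun v : Literature.Probability.LatticeModels.Site 2 => ((v 0 : ℝ) : ℂ) + ((v 1 : ℝ) : ℂ) * Complex.I) R.carrier δ (R.arc 0) (R.arc 2)})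

/-- The standard-embedding bond-ℤ² crude crossing probability (the crux's consequent family, verbatim). -/
noncomputable def bondStdCrossingProb (R : Literature.Probability.RandomPlanarGeometry.ConformalRectangle) : ℝ → ℝ :=
  (fun δ ↦ (Literature.Probability.Percolation.bondPercolation (Literature.Probability.LatticeModels.zdGraph 2) Literature.Probability.Percolation.half).real (Literature.Probability.Percolation.embDomainCrossing Literature.Probability.LatticeModels.squareLatticeEmbedding.z R.carrier δ (R.arc 0) (R.arc 2)))

/-- The isotropic Izergin–Korepin defect density `p_IK = 2√3 − 3` (`t = √3/2`). -/
noncomputable def pIK : ℝ := 2 * Real.sqrt 3 - 3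

/-- SANITY (`rfl`): the crux, by name, is literally the `p = p_IK` instance of the abstraction. -/
theorem cornerLineDescent_eq :
    Theses.CardyIKTransport.CornerLineDescent =
      ((∀ R : ConformalRectangle, R.HasCrossingLimit (cornerCrossingProb pIK R) cardyFunction) →
        ∀ R : ConformalRectangle, R.HasCrossingLimit (bondStdCrossingProb R) cardyFunction) := by
  rfl

/-! ## Card `dislocation-seam-calculus` — first lemma (frozen end; RSW + `α₄ > 1` technology) -/

/-- **FiniteDislocationsHarmless.** With `p = λ δ²` the number of plaquette defects (= edge
dislocations of the renewal square lattice, Burgers vector `(±1,±1)` read from the two grid-line bits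
at the face) in a bounded domain stays tight as `δ → 0⁺`, and crude crossing probabilities differ from
those of the defect-free model (`p = 0`: bond-ℤ² at `1/2` on the renewal grid) by `o(1)`: finitely many
dislocations are invisible in the limit (seam to the boundary × four-arm bound `δ^{1+ε}` per seam
bond, twisted-annulus arm estimates near the cores). -/
def FiniteDislocationsHarmless : Prop :=
  ∀ lam : ℝ, 0 ≤ lam → ∀ R : ConformalRectangle,
    Tendsto (fun δ : ℝ => cornerCrossingProb (lam * δ ^ 2) R δ - cornerCrossingProb 0 R δ)
      (𝓝[>] 0) (𝓝 0)

/-- **SparseDislocationsHarmless** (uniform form used by the tower): for some `η > 0`, defect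
densities `p ≤ δ^{2-η}` — `N = o(δ^{-η})` dislocations per unit area, matched in Burgers-neutral pairs
by seams of lattice length `N^{-1/2} δ^{-1}`, total pivotal seam mass `≲ √N · δ^{ε}` — do not move crude
crossing probabilities, uniformly in `p`. (With `α₄ = 5/4` the same calculus reaches `p ≪ δ^{3/2}`;
`p` of order one is the universality wall of the crux.) -/
def SparseDislocationsHarmless : Prop :=
  ∃ η : ℝ, 0 < η ∧ ∀ R : ConformalRectangle, ∀ ε : ℝ, 0 < ε → ∃ δ₀ : ℝ, 0 < δ₀ ∧
    ∀ δ : ℝ, 0 < δ → δ < δ₀ → ∀ p : ℝ, 0 ≤ p → p ≤ δ ^ (2 - η) →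
      |cornerCrossingProb p R δ - cornerCrossingProb 0 R δ| ≤ ε

/-- **FreezeToStandard** (support, `t = 0` end, in-gauge form of `RenewalGridHarmless` stmt-4967 ∘
`FreezeIdentification`): Cardy for the defect-free gauge model in every conformal rectangle implies
Cardy for the standard embedding (homogenisation of i.i.d. geometric grid spacings, mean 2). -/
def FreezeToStandard : Prop :=
  (∀ R : ConformalRectangle, R.HasCrossingLimit (cornerCrossingProb 0 R) cardyFunction) →
    ∀ R : ConformalRectangle, R.HasCrossingLimit (bondStdCrossingProb R) cardyFunction

/-- **SeamReduction**: the frozen end of the crux as the card cuts it — any proof of the descent that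
lands in the sparse window only has to supply `SparseWindowDescent` (Cardy for `P_IK` ⇒ Cardy along SOME
sequence of sparse models); shape only, the content is in the two harmlessness lemmas. -/
def SparseWindowDescent : Prop :=
  (∀ R : ConformalRectangle, R.HasCrossingLimit (cornerCrossingProb pIK R) cardyFunction) →
    ∃ η : ℝ, 0 < η ∧ ∃ q : ℝ → ℝ, (∀ δ, 0 < δ → 0 ≤ q δ ∧ q δ ≤ δ ^ (2 - η)) ∧
      ∀ R : ConformalRectangle, R.HasCrossingLimit (fun δ => cornerCrossingProb (q δ) R δ) cardyFunction

/-! ## Card `poisson-corner-refinement-tower` — first lemma (exact, provable now) and the transfer -/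

/-- Defect density after `n`-fold XOR-composition: `1 - 2·(iterXor n p) = (1 - 2p)^n`. -/
noncomputable def iterXor (n : ℕ) (p : ℝ) : ℝ := (1 - (1 - 2 * p) ^ n) / 2

/-- **DecimationIdentity** (exact self-similarity of the colouring in the typed gauge): restricted to
the sublattice `kℤ × kℤ`, the colouring has the law of the full colouring at defect density
`iterXor (k^2) p` — every cylinder probability agrees (`σ(kv) = A(kv0) ⊕ B(kv1) ⊕` parity of `D` over a
union of `k × k` blocks, and block parities are i.i.d. Bernoulli(`iterXor (k^2) p`)). Coins take no part.
Continuum reading: every corner-line colouring is ONE Poisson quadrant-parity field restricted to a square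
grid of cell area `s(p) = -log(1-2p)/2` (`s(p_IK) = log(2+√3)`). -/
def DecimationIdentity : Prop :=
  ∀ p : ℝ, 0 ≤ p → p ≤ 1 → ∀ k : ℕ, 1 ≤ k → ∀ n : ℕ, ∀ vs : Fin n → Site 2, ∀ c : Fin n → Prop,
    (cornerMeasure p).real {ω | ∀ i, cornerColour ω ((k : ℤ) • vs i) ↔ c i} =
      (cornerMeasure (iterXor (k ^ 2) p)).real {ω | ∀ i, cornerColour ω (vs i) ↔ c i}

/-- One refinement step DOWN the tower: halve the mesh and quarter the corner intensity per cell,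
`1 - 2·quarterArea p = (1-2p)^{1/4}`, so that the macroscopic dislocation intensity `s(p)/δ²` is kept
(and the coarse colouring is exactly the even-sublattice restriction of the fine one, by
`DecimationIdentity` with `k = 2`). -/
noncomputable def quarterArea (p : ℝ) : ℝ := (1 - (1 - 2 * p) ^ (1 / 4 : ℝ)) / 2

/-- **LevelCoherence** (the TRANSFER `C⁺`, per conformal rectangle): a uniform power rate for ONE
refinement step of the Poisson-corner tower, uniformly along the corner line `p ∈ [0, p_IK]`. Its `p = 0`
member is dyadic two-mesh coherence of bond-ℤ² itself (on renewal grids). -/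
def LevelCoherence (R : ConformalRectangle) : Prop :=
  ∃ C b : ℝ, 0 < b ∧ ∀ p : ℝ, 0 ≤ p → p ≤ pIK → ∀ δ : ℝ, 0 < δ → δ < 1 →
    |cornerCrossingProb p R δ - cornerCrossingProb (quarterArea p) R (δ / 2)| ≤ C * δ ^ b

/-- **TowerReduction** (assembly of the card; elementary real analysis — telescope `J(δ') → ∞`
refinement steps from a coarse mesh `δ(δ') → 0` down to `δ' = δ 2^{-J}`, land in the sparse window
`iterate quarterArea J p_IK ≤ δ'^{2-η}`, freeze, homogenise): the three statements imply the crux BY NAME. -/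
def TowerReduction : Prop :=
  (∀ R : ConformalRectangle, LevelCoherence R) → SparseDislocationsHarmless → FreezeToStandard →
    Theses.CardyIKTransport.CornerLineDescent

end Summit.CriticalPhenomena.CardyFormulaZ2.Cruxes.CornerLineDescent.IdeatorThree
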